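import Summits.QuantumFields.YangMills.Theses.SqueezedSkewness
import HarnessLib

/-!
# Route `SqueezedSkewness`, item `SqueezedFactorisationGlue` (stmt-QuantumFields-27864) — glue of the split of `SqueezedFactorisation`

`theorem squeezedSkewness_squeezedFactorisationGlue : SqueezedFactorisationGlue`, i.e.
`ShellGeometry → ShellSign → ClauseOneMoments → CeilingFromMoments → SqueezedFactorisation` (split gen 1 of
stmt-QuantumFields-25917, route rev 2, commit 2b2e75c4c5d0).  Pure real arithmetic: `c·Q2 ≤ σ·Q3 ≤ |Q3| ≤ M ≤ (M/ε)·Q2`;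
with `C' = max (M/ε) (2c)`, `w = (c + C')/2`, `δ = (C' − c)/(C' + c) < 1`: `|Q3 − σ·w·Q2| = |σ·Q3 − w·Q2| ≤ ((C' − c)/2)·Q2 = δ·w·Q2`.

R3/RECORD framing: route glue only — the line's open obligations remain `ShellSign` (27861), `ClauseOneMoments` (27862),
`ShellGeometry` (27860), `CeilingFromMoments` (27863) and the residual `PointlikeMirrorFloors` (25918); NT and a fortiori the
Yang–Mills mass gap are NOT proved here.
-/

set_option autoImplicit false

namespace Summit.QuantumFields.YangMills.Theorems

open Literature.MathematicalPhysics.QuantumFieldTheory Literature.MathematicalPhysics.QuantumLattice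
open Summit.QuantumFields.YangMills.Cruxes.OSLegsFromFemtoAndGap.DlrCollarTransfer
open Summit.QuantumFields.YangMills.Theses.SqueezedSkewness

/-- Points of the closed ball of radius `ρ < 1` around `e₀` have positive time coordinate. -/
theorem squeezedSkewness_pos_time_of_mem_closedBall {ρ : ℝ} (hρ : ρ < 1) {y : EuclideanSpace ℝ (Fin 4)}
    (hy : y ∈ Metric.closedBall (EuclideanSpace.single (0 : Fin 4) (1 : ℝ)) ρ) : 0 < y 0 := by
  rw [Metric.mem_closedBall, dist_eq_norm] at hy
  have h1 : |(y - EuclideanSpace.single (0 : Fin 4) (1 : ℝ)) 0| ≤ ‖y - EuclideanSpace.single (0 : Fin 4) (1 : ℝ)‖ := by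
    have := PiLp.norm_apply_le (p := 2) (y - EuclideanSpace.single (0 : Fin 4) (1 : ℝ)) 0
    simpa [Real.norm_eq_abs] using this
  have h2 : (y - EuclideanSpace.single (0 : Fin 4) (1 : ℝ)) 0 = y 0 - 1 := by
    simp
  rw [h2] at h1
  have h3 := (abs_le.mp (h1.trans hy)).1
  linarith

/-- **Route `SqueezedSkewness`, item `SqueezedFactorisationGlue` (stmt-QuantumFields-27864):**
`ShellGeometry → ShellSign → ClauseOneMoments → CeilingFromMoments → SqueezedFactorisation`.
Arithmetic: `c·Q2 ≤ σ·Q3 ≤ |Q3| ≤ M ≤ (M/ε)·Q2`; with `C' = max (M/ε) (2c)`, `w = (c + C')/2`, `δ = (C' − c)/(C' + c) < 1`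
one gets `|Q3 − σ·w·Q2| = |σ·Q3 − w·Q2| ≤ ((C' − c)/2)·Q2 = δ·w·Q2`. -/
theorem squeezedSkewness_squeezedFactorisationGlue :
    Summit.QuantumFields.YangMills.Theses.SqueezedSkewness.SqueezedFactorisationGlue := by
  unfold Summit.QuantumFields.YangMills.Theses.SqueezedSkewness.SqueezedFactorisationGlue
  intro hGeo hSign hPin hCeil G _ _ _ _ hG
  letI : MeasurableSpace G := borel G
  haveI : BorelSpace G := ⟨rfl⟩
  intro r a ha ha0
  obtain ⟨ℓ, hℓ, hℓ4, H⟩ := hSign G hG r a ha ha0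
  obtain ⟨h, hshell, hdisj⟩ := hGeo ℓ hℓ hℓ4
  obtain ⟨ρ, hρ, hρℓ, Hv⟩ := H h hshell
  refine ⟨ρ, hρ, fun v hv0 hball hfl => ?_⟩
  obtain ⟨d1, d2, d3⟩ := hdisj v (hball.trans (Metric.closedBall_subset_closedBall hρℓ))
  obtain ⟨σ, c, hσ, hc, β₆, Λ₆, hlow⟩ := Hv v hv0 hball hfl
  obtain ⟨ε, β₅, Λ₅, hε, hfloor⟩ := hfl
  have hρ1 : ρ < 1 := by linarith
  have hpos : tsupport (v : EuclideanSpace ℝ (Fin 4) → ℝ) ⊆ {y : EuclideanSpace ℝ (Fin 4) | 0 < y 0} :=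
    fun y hy => squeezedSkewness_pos_time_of_mem_closedBall hρ1 (hball hy)
  have hMB : MomentBounds6 G r a := hPin G hG r a ha ha0 ⟨v, ε, β₅, Λ₅, hpos, hε, hfloor⟩
  obtain ⟨M, β₇, Λ₇, hup⟩ := hCeil G hG r a ha ha0 hMB ℓ hℓ hℓ4 h hshell.2.1 ρ hρ hρℓ v hball
  refine ⟨h, d1, d2, d3, ?_⟩
  set C' : ℝ := max (M / ε) (2 * c) with hC'
  have hC'c : 2 * c ≤ C' := le_max_right _ _
  have hC'M : M / ε ≤ C' := le_max_left _ _
  have hsum : 0 < C' + c := by linarith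
  refine ⟨(c + C') / 2, (C' - c) / (C' + c), σ, by linarith, ?_, hσ, max β₅ (max β₆ β₇), max Λ₅ (max Λ₆ Λ₇),
    fun β hβ L hL => ?_⟩
  · rw [div_lt_one hsum]; linarith
  have hβ5 : β₅ ≤ β := le_trans (le_max_left _ _) hβ
  have hβ6 : β₆ ≤ β := le_trans (le_trans (le_max_left _ _) (le_max_right _ _)) hβ
  have hβ7 : β₇ ≤ β := le_trans (le_trans (le_max_right _ _) (le_max_right _ _)) hβ
  have hL5 : Λ₅ ≤ a β * L := le_trans (le_max_left _ _) hL
  have hL6 : Λ₆ ≤ a β * L := le_trans (le_trans (le_max_left _ _) (le_max_right _ _)) hL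
  have hL7 : Λ₇ ≤ a β * L := le_trans (le_trans (le_max_right _ _) (le_max_right _ _)) hL
  set q : ℝ := Q2 G r β L (a β) (thetaTest 4 v) v with hq
  set t : ℝ := Q3 G r β L (a β) v (thetaTest 4 v) h with ht
  have hF : ε ≤ q := hfloor β hβ5 L hL5
  have hlo : c * q ≤ σ * t := hlow β hβ6 L hL6
  have hhi : |t| ≤ M := hup β hβ7 L hL7
  have hqpos : 0 < q := lt_of_lt_of_le hε hF
  have hM0 : 0 ≤ M := le_trans (abs_nonneg _) hhi
  have hσabs : |σ| = 1 := by rcases hσ with rfl | rfl <;> simp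
  have hst : σ * t ≤ C' * q := by
    have h1 : σ * t ≤ |t| := by
      have := le_abs_self (σ * t); rw [abs_mul, hσabs, one_mul] at this; exact this
    have h2 : M ≤ M / ε * q := by
      rw [div_mul_eq_mul_div, le_div_iff₀ hε]; exact mul_le_mul_of_nonneg_left hF hM0
    have h3 : M / ε * q ≤ C' * q := mul_le_mul_of_nonneg_right hC'M hqpos.le
    linarith
  have hkey : |σ * t - (c + C') / 2 * q| ≤ (C' - c) / 2 * q := by
    rw [abs_le]; constructor <;> nlinarith
  have hrew : t - σ * ((c + C') / 2) * q = σ * (σ * t - (c + C') / 2 * q) := by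
    have hσ2 : σ * σ = 1 := by rcases hσ with rfl | rfl <;> norm_num
    linear_combination (-t) * hσ2
  have hδw : (C' - c) / (C' + c) * ((c + C') / 2) * q = (C' - c) / 2 * q := by
    field_simp
    ring
  rw [hrew, abs_mul, hσabs, one_mul, hδw]
  exact hkey


end Summit.QuantumFields.YangMills.Theorems
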